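import Summits.FinalStateConjecture.FinalStateConjecture.Theorems.StarvedNecksNeckGapDecayTwistChart
import Summits.FinalStateConjecture.FinalStateConjecture.Theorems.StarvedNecksNeckGapDecayOfCore
import Literature.Geometry.Lorentzian.BoostedKerrCausalLegs
import HarnessLib

/-!
# An HONEST input whose hole chart is NOT self-certified: the twisted exact Schwarzschild decomposition
# (crux `StarvedNecks.NeckGapDecay`, stmt-FinalStateConjecture-16768, line `Sketch`; `--supports`)

Model check for the physics stub P-core of the line `Sketch` (`…Theorems.NeckGapDecay.ConnectionLevelCones.
OfCore.GapCoreHolds`, skeleton `Cruxes/NeckGapDecay/Lines/Sketch.lean` v9).  Since v5 the skeleton splits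
every hole into the SELF-CERTIFIED case (the input chart already has `C²` deviation `→ 0` below some normalised
dominating wall — closed by structure alone, `OfCoreGlue.cert_of_selfCertified`) and its complement, for which
alone the physics is invoked.  This file kernel-checks that the complement is INHABITED BY HONEST INPUTS in the
crux's own vocabulary ("Core" shape: arbitrary spacetime, the crux's `Hc`/`Hf`/DV let-lambdas verbatim):

* `decompT P k` — the exact Schwarzschild `N = 1` decomposition of the crux disprover (`SchwGap.decompK`,
  p137987) with the identity hole chart replaced by the TWISTED chart `Ψ_T = Ψ ∘ K` of `…TwistChart`
  (`K x = R_{β(x)} x`, `β = cTw S(‖x⃗‖²/λ(x⁰)²)`, `λ = R₀ + 2 + ¼ log(1 + t²)`); its fixed-radius convergence is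
  EXACT (the twist is the identity inside the receding radius `λ(t) → ∞`), all other structure clauses are those
  of `decompK` because the twist is a homeomorphism of the domain preserving hole time and radius;
* `honestCore_decompT`, `honestFar_decompT`, `distinctVelocities_decompT` — the crux's antecedents hold
  (clauses on time/radius-defined images transfer from `decompK`; the new content is `Hf`(3): the twisted
  chart is `C⁰`-honest, `‖Ψ_T^* g − g_B‖ ≤ 1/10`, by the lever-arm bound `‖dβ‖ ‖x⃗‖ ≤ 3/100`);
* `not_selfCertified_decompT` — for EVERY threshold and EVERY normalised wall dominating `3ρ + 2`, the `C²`
  (indeed `C⁰`) deviation of `Ψ_T` on the sub-wall slabs does NOT tend to `0`: the twist shell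
  `[λ(τ), √2 λ(τ)]` lies below the wall and carries deviation `≥ cTw` (mean value theorem);
* `exists_honest_not_selfCertified` — packaged: the hypotheses of `GapCoreHolds` minus its
  MGHD/provenance prefix are jointly satisfiable together with "hole `i` not self-certified", for every hole.

So the physics stub is genuinely invoked on honest inputs (this was Disproof §C(4) / lead-c2 Audit B.3 on
paper); what no model can show is the physics itself.  References: Kerr–Schild 1965 §2–3; O'Neill 1995,
Ch. 2, §2.2; DHRT arXiv:2104.08222 §1; Dafermos–Rodnianski arXiv:0811.0354 §5.1.
-/

noncomputable section

open Set Function Filter Topology TopologicalSpace Manifold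
open scoped Topology ContDiff Manifold ENNReal

namespace Summit.FinalStateConjecture.FinalStateConjecture.Theorems.NeckGapDecay.ConnectionLevelCones.Twist

open Literature.Geometry.Lorentzian
open Summit.FinalStateConjecture.FinalStateConjecture.Theorems.SeamedChartsExhaust.Negative
open Summit.FinalStateConjecture.FinalStateConjecture.Theorems.SeamedChartsExhaust.Negative.SchwModel
open Summit.FinalStateConjecture.FinalStateConjecture.Theorems.NeckGapDecay.Negative

-- the problem namespace `Summit.FinalStateConjecture.FinalStateConjecture` repeats the summit name by design
set_option linter.dupNamespace false
-- instance search through nested operator types `E4 →L E4 →L E4 →L ℝ` (as in the tree files)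
set_option maxSynthPendingDepth 3

variable (P : Params)

/-! ## Exact fixed-radius convergence of the twisted chart -/

/-- On a truncated slab `{t = τ, r ≤ R}` with `|R| + 1 ≤ λ(τ)` every derivative of the extended deviation of
the twisted chart vanishes, so its `Cᵏ` sup norm is `0`. [folklore] -/
theorem truncDeviationCk_ΨT_eq_zero (k : ℕ) {R τ : ℝ} (hτ : |R| + 1 ≤ lam (bP P) τ) :
    (ST P).truncDeviationCk (Bh P) (ΨT P) k R τ = 0 := by
  refine le_antisymm (iSup₂_le fun m _ ↦ iSup₂_le fun y hy ↦ ?_) bot_le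
  obtain ⟨x, ⟨hxt, hxr⟩, rfl⟩ := hy
  have hxt' : x.1 0 = τ := by rwa [bg_time] at hxt
  have hxr' : E4.spatialNorm x.1 ≤ R := by rwa [bg_radius, Kerr.radius_zero_left] at hxr
  have hinner : qsq x.1 < lam (bP P) (x.1 0) ^ 2 := by
    rw [qsq_eq, hxt']
    have h0 := E4.spatialNorm_nonneg x.1
    have h1 : E4.spatialNorm x.1 < lam (bP P) τ := by linarith [le_abs_self R]
    nlinarith
  rw [iteratedFDeriv_deviationExtend_ΨT_eq_zero P hinner m]
  simp

/-- **Fixed-radius convergence of the twisted chart is exact**: eventually in `τ` the truncated `Cᵏ`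
deviation is `0`, hence tends to `0`. [folklore] -/
theorem tendsto_truncDeviationCk_ΨT (k : ℕ) (R : ℝ) :
    Tendsto (fun τ ↦ (ST P).truncDeviationCk (Bh P) (ΨT P) k R τ) atTop (𝓝 0) := by
  have hev : ∀ᶠ τ in atTop, (ST P).truncDeviationCk (Bh P) (ΨT P) k R τ = 0 := by
    filter_upwards [(tendsto_lam_atTop (bP P)).eventually_ge_atTop (|R| + 1)] with τ hτ
    exact truncDeviationCk_ΨT_eq_zero P k hτ
  exact tendsto_const_nhds.congr' (hev.mono fun τ h ↦ h.symm)

/-! ## The twisted decomposition -/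

/-- **The twisted exact Schwarzschild decomposition** in class `Cᵏ`: `SchwGap.decompK P k` with the hole chart
replaced by the twisted chart `Ψ_T`. [folklore] -/
def decompT (k : ℕ) : FinalStateDecomposition (ST P) (O P) k where
  N := 1
  mass _ := P.M
  spin _ := 0
  mass_pos _ := P.hM
  abs_spin_le_mass _ := by rw [abs_zero]; exact P.hM.le
  motion _ := (1, 0)
  τ₀ := 1
  chart _ := ΨT P
  isLateChart _ := isLateChart_ΨT P 1
  tendsto_truncDeviationCk _ R := tendsto_truncDeviationCk_ΨT P k R
  exists_pairwise_disjoint _ := ⟨0, Subsingleton.pairwise⟩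
  excision _ := ρ P
  tendsto_excision_div _ := ρ_div_tendsto P
  flatDomain := U P
  setOf_lt_excision_subset_flatDomain := (SchwGap.decompK P k).setOf_lt_excision_subset_flatDomain
  flatChart := Φ P
  isLateChart_flat := SchwGap.isLateChart_Φ_at P 1
  tendsto_deviationCk_flat := (SchwGap.decompK P k).tendsto_deviationCk_flat
  diff_subset_causalPast := by
    have h1 : ΨT P '' (Bh P).lateRegion 1 = Ψ P '' (Bh P).lateRegion 1 :=
      image_ΨT_eq P (mem_iff_KT_mem P (p := fun t _ ↦ 1 < t))
    have h2 : ΨT P '' (Bh P).timeSlab 1 = Ψ P '' (Bh P).timeSlab 1 :=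
      image_ΨT_eq P (mem_iff_KT_mem P (p := fun t _ ↦ t = 1))
    have h := (SchwGap.decompK P k).diff_subset_causalPast
    change O P \ ((⋃ i : Fin 1, Ψ P '' (Bh P).lateRegion 1) ∪ Φ P '' (Minkowski.backgroundOn (U P)).lateRegion 1) ⊆
      (ST P).metric.causalPast (ST P).timeOrientation
        ((⋃ i : Fin 1, Ψ P '' (Bh P).timeSlab 1) ∪ Φ P '' (Minkowski.backgroundOn (U P)).timeSlab 1) at h
    show O P \ ((⋃ i : Fin 1, ΨT P '' (Bh P).lateRegion 1) ∪ Φ P '' (Minkowski.backgroundOn (U P)).lateRegion 1) ⊆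
      (ST P).metric.causalPast (ST P).timeOrientation
        ((⋃ i : Fin 1, ΨT P '' (Bh P).timeSlab 1) ∪ Φ P '' (Minkowski.backgroundOn (U P)).timeSlab 1)
    rw [h1, h2]
    exact h

variable (k : ℕ)

/-- One hole. [folklore] -/
theorem decompT_N : (decompT P k).N = 1 := rfl
/-- Late time `1`. [folklore] -/
theorem decompT_τ₀ : (decompT P k).τ₀ = 1 := rfl
/-- The hole chart is the twisted chart. [folklore] -/
theorem decompT_chart (i : Fin (decompT P k).N) : (decompT P k).chart i = ΨT P := rfl
/-- The hole background. [folklore] -/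
theorem decompT_background (i : Fin (decompT P k).N) : (decompT P k).background i = Bh P := rfl
/-- The excision radius. [folklore] -/
theorem decompT_excision (i : Fin (decompT P k).N) : (decompT P k).excision i = ρ P := rfl
/-- The motion is trivial. [folklore] -/
theorem decompT_motion (i : Fin (decompT P k).N) : (decompT P k).motion i = (1, 0) := rfl
/-- The flat chart is the model's. [folklore] -/
theorem decompT_flatChart : (decompT P k).flatChart = Φ P := rfl
/-- The flat domain is the model's. [folklore] -/
theorem decompT_flatDomain : (decompT P k).flatDomain = U P := rfl

/-- `Fin (decompT P k).N` is a subsingleton. [folklore] -/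
theorem subsingleton_fin_N_T : Subsingleton (Fin (decompT P k).N) := by
  rw [decompT_N]; infer_instance

/-- The label boost has operator norm `≤ 1` (it is the identity). [folklore] -/
theorem norm_motion_le_one (i : Fin (decompT P k).N) :
    ‖((((decompT P k).motion i).1 : E4 ≃L[ℝ] E4) : E4 →L[ℝ] E4)‖ ≤ 1 := by
  refine ContinuousLinearMap.opNorm_le_bound _ zero_le_one fun v ↦ ?_
  have : ((((decompT P k).motion i).1 : E4 ≃L[ℝ] E4) : E4 →L[ℝ] E4) v = v := rfl
  rw [this, one_mul]

/-! ## The crux's antecedents hold on the twisted input -/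

/-- **`HonestCore` holds on the twisted input** (the crux's `Hc` let-lambda, verbatim): (a) as for `decompK`;
(b), (c) the anchoring / closedness clauses concern `Ψ_T`-images of time/radius-defined sets, which are the
`Ψ`-images (`image_ΨT_eq`), so they are `decompK`'s; (d) the flat chart is `decompK`'s. [folklore] -/
theorem honestCore_decompT :
    let Hc := ( fun (𝓢 : Spacetime.{0} 4) (O : Set 𝓢.carrier) (k : ℕ) (d : FinalStateDecomposition 𝓢 O k) (R₀ : ℝ) => let B := d.background; let t := fun i ↦ (B i).time; let r := fun i ↦ (B i).radius; let Ψ := d.chart; (∀ i, Kerr.IsSubextremal (d.mass i) (d.spin i) ∧ 100 * d.mass i ≤ R₀ ∧ 0 < ((d.motion i).1 : E4 ≃L[ℝ] E4) (E4.basisVector 0) 0) ∧ (∀ i (ϱ τ₂ : ℝ), R₀ ≤ ϱ → d.τ₀ < τ₂ → Ψ i '' {x | d.τ₀ < t i x.1 ∧ t i x.1 < τ₂ ∧ r i x.1 < ϱ} ⊆ 𝓢.metric.causalPast 𝓢.timeOrientation (Ψ i '' (B i).truncTimeSlab ϱ τ₂)) ∧ (∀ i (τ' : ℝ) (ϱ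 : ℝ → ℝ), Continuous ϱ → d.τ₀ < τ' → let A := Ψ i '' {x | τ' ≤ t i x.1 ∧ r i x.1 ≤ ϱ (t i x.1)}; closure A ∩ O ⊆ A) ∧ (∀ y : d.flatDomain, d.τ₀ < y.1 0 → 𝓢.timeOrientation.IsFutureDirected (mfderiv 𝓘(ℝ, E4) (𝓡 4) d.flatChart y (E4.basisVector 0))) )
    Hc (ST P) (O P) k (decompT P k) P.R₀ := by
  intro Hc
  have hK := SchwGap.honestCore_decompK P k
  obtain ⟨hKa, hKb, hKc, hKd⟩ := hK
  refine ⟨fun i ↦ hKa (Fin.cast rfl i), ?_, ?_, hKd⟩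
  · intro i ϱ τ₂ hϱ hτ₂
    have h := hKb (Fin.cast rfl i) ϱ τ₂ hϱ hτ₂
    simp only [SchwGap.decompK_chart, SchwGap.decompK_background, SchwGap.decompK_τ₀] at h
    show ΨT P '' {x | 1 < (Bh P).time x.1 ∧ (Bh P).time x.1 < τ₂ ∧ (Bh P).radius x.1 < ϱ} ⊆
      (ST P).metric.causalPast (ST P).timeOrientation (ΨT P '' (Bh P).truncTimeSlab ϱ τ₂)
    rw [image_ΨT_eq P (mem_iff_KT_mem P (p := fun t r ↦ 1 < t ∧ t < τ₂ ∧ r < ϱ)),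
      show (Bh P).truncTimeSlab ϱ τ₂ = {y : (Bh P).domain | (fun t r ↦ t = τ₂ ∧ r ≤ ϱ) ((Bh P).time y.1) ((Bh P).radius y.1)}
        from rfl, image_ΨT_eq P (mem_iff_KT_mem P (p := fun t r ↦ t = τ₂ ∧ r ≤ ϱ))]
    exact h
  · intro i τ' ϱ hϱ hτ'
    have h := hKc (Fin.cast rfl i) τ' ϱ hϱ hτ'
    simp only [SchwGap.decompK_chart, SchwGap.decompK_background] at h
    show closure (ΨT P '' {x | τ' ≤ (Bh P).time x.1 ∧ (Bh P).radius x.1 ≤ ϱ ((Bh P).time x.1)}) ∩ O P ⊆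
      ΨT P '' {x | τ' ≤ (Bh P).time x.1 ∧ (Bh P).radius x.1 ≤ ϱ ((Bh P).time x.1)}
    rw [image_ΨT_eq P (mem_iff_KT_mem P (p := fun t r ↦ τ' ≤ t ∧ r ≤ ϱ t))]
    exact h

/-- **`HonestFar` holds on the twisted input** (the crux's `Hf` let-lambda, verbatim): (1), (2) concern the
flat chart only (= `decompK`'s); (3) is the `C⁰` HONESTY of the twisted hole chart on its Voronoi cell —
everywhere, in fact: `‖Ψ_T^* g − g_B‖ ≤ 1/10 = 1/(10‖1‖²)` (`norm_deviation_ΨT_le`). [folklore] -/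
theorem honestFar_decompT :
    let Hf := ( fun (𝓢 : Spacetime.{0} 4) (O : Set 𝓢.carrier) (k : ℕ) (d : FinalStateDecomposition 𝓢 O k) (R₀ : ℝ) => let B := d.background; let t := fun i ↦ (B i).time; let r := fun i ↦ (B i).radius; let Φ := d.flatChart; (∀ τ₂ : ℝ, d.τ₀ < τ₂ → Φ '' {y | d.τ₀ < y.1 0 ∧ y.1 0 < τ₂} ⊆ 𝓢.metric.causalPast 𝓢.timeOrientation (Φ '' (Minkowski.backgroundOn d.flatDomain).timeSlab τ₂)) ∧ (∀ τ' : ℝ, d.τ₀ < τ' → closure (Φ '' {y | τ' ≤ y.1 0 ∧ ∀ i, d.excision i (y.1 0) + 1 ≤ r i y.1}) ⊆ Φ '' {y | τ' ≤ y.1 0}) ∧ (∀ i, ∃ T : ℝ, supCkENorm (Subtype.val '' {x : (B i).domain | T ≤ t i x.1 ∧ R₀ ≤ r i x.1 ∧ ∀ j, j ≠ i → r i x.1 ≤ r j x.1}) 0 (𝓢.deviationExtend (B i) (d.chart i)) ≤ ENNReal.ofReal (1 / (10 * ‖(((d.motion i).1 : E4 ≃L[ℝ] E4) : E4 →L[ℝ]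 E4)‖ ^ 2))) )
    Hf (ST P) (O P) k (decompT P k) P.R₀ := by
  intro Hf
  have hK := SchwGap.honestFar_decompK P k
  obtain ⟨hK1, hK2, -⟩ := hK
  refine ⟨hK1, ?_, ?_⟩
  · intro τ' hτ'
    have h := hK2 τ' hτ'
    have hset : {y : (decompT P k).flatDomain | τ' ≤ y.1 0 ∧ ∀ i : Fin (decompT P k).N,
        (decompT P k).excision i (y.1 0) + 1 ≤ ((decompT P k).background i).radius y.1} =
        {y : (SchwGap.decompK P k).flatDomain | τ' ≤ y.1 0 ∧ ∀ i : Fin (SchwGap.decompK P k).N,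
        (SchwGap.decompK P k).excision i (y.1 0) + 1 ≤ ((SchwGap.decompK P k).background i).radius y.1} := by
      ext y
      simp only [mem_setOf_eq, decompT_excision, decompT_background]
      constructor
      · rintro ⟨h1, h2⟩; exact ⟨h1, fun i ↦ h2 (Fin.cast rfl i)⟩
      · rintro ⟨h1, h2⟩; exact ⟨h1, fun i ↦ h2 (Fin.cast rfl i)⟩
    show closure ((decompT P k).flatChart '' _) ⊆ _
    rw [hset]
    exact h
  · intro i
    refine ⟨0, ?_⟩
    -- pointwise `C⁰` honesty `≤ 1/10`, and `‖1‖ ≤ 1`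
    have hn := norm_motion_le_one P k i
    have hthr : ENNReal.ofReal (1 / 10) ≤
        ENNReal.ofReal (1 / (10 * ‖((((decompT P k).motion i).1 : E4 ≃L[ℝ] E4) : E4 →L[ℝ] E4)‖ ^ 2)) := by
      apply ENNReal.ofReal_le_ofReal
      have h0 : 0 < ‖((((decompT P k).motion i).1 : E4 ≃L[ℝ] E4) : E4 →L[ℝ] E4)‖ :=
        one_pos.trans_le (BoostedKerrLegs.one_le_norm_lorentz _)
      rw [div_le_div_iff₀ (by norm_num) (by positivity)]
      nlinarith [norm_nonneg ((((decompT P k).motion i).1 : E4 ≃L[ℝ] E4) : E4 →L[ℝ] E4)]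
    refine le_trans ?_ hthr
    refine iSup₂_le fun m hm ↦ iSup₂_le fun y hy ↦ ?_
    obtain ⟨x, -, rfl⟩ := hy
    have hm0 : m = 0 := Nat.le_zero.mp hm
    subst hm0
    rw [← ofReal_norm, norm_iteratedFDeriv_zero]
    apply ENNReal.ofReal_le_ofReal
    show ‖(ST P).deviationExtend (Bh P) (ΨT P) x.1‖ ≤ 1 / 10
    rw [(ST P).deviationExtend_coe (Bh P) (ΨT P) x]
    exact norm_deviation_ΨT_le P x

/-- **Distinct velocities** hold on the twisted input (one hole: vacuous). [folklore] -/
theorem distinctVelocities_decompT :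
    ∀ i j : Fin (decompT P k).N, i ≠ j → (((decompT P k).motion i).1 : E4 ≃L[ℝ] E4) (E4.basisVector 0) ≠
      (((decompT P k).motion j).1 : E4 ≃L[ℝ] E4) (E4.basisVector 0) :=
  fun i j hij _ ↦ hij ((subsingleton_fin_N_T P k).elim i j)

/-! ## The twisted hole chart is not self-certified -/

/-- The twist shell lies below every wall dominating `3ρ + 2`: `3/2 · λ(τ) ≤ 3 ρ(τ) + 2` for `τ ≥ 0`
(`log(1 + τ²) ≤ 4 (1 + √τ)`). [folklore] -/
theorem shell_le_wall {τ : ℝ} (hτ : 0 ≤ τ) : 3 / 2 * lam (bP P) τ ≤ 3 * ρ P τ + 2 := by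
  have hR := P.R₀_pos
  have hlog : Real.log (1 + τ ^ 2) ≤ 4 * (1 + Real.sqrt τ) := by
    have h1 : Real.log (1 + τ ^ 2) ≤ Real.log ((1 + τ) ^ 2) :=
      Real.log_le_log (by positivity) (by nlinarith)
    have h2 : Real.log ((1 + τ) ^ 2) = 4 * Real.log (Real.sqrt (1 + τ)) := by
      rw [Real.log_pow, Real.log_sqrt (by positivity)]; push_cast; ring
    have h3 : Real.log (Real.sqrt (1 + τ)) ≤ Real.sqrt (1 + τ) - 1 :=
      Real.log_le_sub_one_of_pos (Real.sqrt_pos.mpr (by positivity))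
    have h4 : Real.sqrt (1 + τ) ≤ 1 + Real.sqrt τ := by
      rw [Real.sqrt_le_left (by positivity)]
      nlinarith [Real.sq_sqrt hτ, Real.sqrt_nonneg τ]
    linarith
  unfold lam bP ρ
  nlinarith [Real.sqrt_nonneg τ]

/-- **THE TWISTED HOLE CHART IS NOT SELF-CERTIFIED**: for no threshold `T₀` and no normalised wall `W`
dominating `3ρ + 2` from `T₀` does the `C²` deviation of `Ψ_T` on the sub-wall slabs `{t = τ, r ≤ W(x⁰)}`
tend to `0` — on each late slab the twist shell lies below the wall and carries deviation `≥ cTw`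
(`exists_norm_deviation_ΨT_ge`, `shell_le_wall`). [folklore] -/
theorem not_selfCertified_decompT (i : Fin (decompT P k).N) :
    ¬ ∃ (T₀ : ℝ) (W : ℝ → ℝ), Continuous W ∧ Monotone W ∧ Tendsto (fun s ↦ W s / s) atTop (𝓝 0) ∧
      (∀ s s', s ≤ s' → W s' ≤ W s + 1 / (10 * ‖((((decompT P k).motion i).1 : E4 ≃L[ℝ] E4) : E4 →L[ℝ] E4)‖ ^ 2) * (s' - s)) ∧
      (∀ s, P.R₀ + 2 ≤ W s) ∧ (∀ s, T₀ ≤ s → 3 * (decompT P k).excision i s + 2 ≤ W s) ∧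
      Tendsto (fun τ ↦ supCkENorm (Subtype.val '' {x : ((decompT P k).background i).domain |
        ((decompT P k).background i).time x.1 = τ ∧ ((decompT P k).background i).radius x.1 ≤ W (x.1 0)}) 2
        ((ST P).deviationExtend ((decompT P k).background i) ((decompT P k).chart i))) atTop (𝓝 0) := by
  rintro ⟨T₀, W, -, -, -, -, -, hWall, hT⟩
  simp only [decompT_background, decompT_chart, decompT_excision] at hWall hT
  have hcTw : (0 : ℝ≥0∞) < ENNReal.ofReal cTw := ENNReal.ofReal_pos.mpr cTw_pos
  have hev := (ENNReal.tendsto_nhds_zero.mp hT) (ENNReal.ofReal (cTw / 2)) (ENNReal.ofReal_pos.mpr (half_pos cTw_pos))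
  obtain ⟨τ₁, hτ₁⟩ := (hev.and (eventually_ge_atTop (max T₀ 0))).exists
  obtain ⟨hsmall, hτ₁ge⟩ := hτ₁
  have hT₀ : T₀ ≤ τ₁ := (le_max_left _ _).trans hτ₁ge
  have h0 : 0 ≤ τ₁ := (le_max_right _ _).trans hτ₁ge
  -- the witness point on the slab `τ₁`
  obtain ⟨x, hxt, hxr, -, hxdev⟩ := exists_norm_deviation_ΨT_ge P τ₁
  have hx0 : x.1 0 = τ₁ := by rwa [bg_time] at hxt
  have hxW : (Bh P).radius x.1 ≤ W (x.1 0) := by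
    rw [hx0]
    exact hxr.trans ((shell_le_wall P h0).trans (hWall τ₁ hT₀))
  have hmem : x.1 ∈ Subtype.val '' {y : (Bh P).domain | (Bh P).time y.1 = τ₁ ∧ (Bh P).radius y.1 ≤ W (y.1 0)} :=
    ⟨x, ⟨hxt, hxW⟩, rfl⟩
  have hge : ENNReal.ofReal cTw ≤ supCkENorm (Subtype.val '' {y : (Bh P).domain |
      (Bh P).time y.1 = τ₁ ∧ (Bh P).radius y.1 ≤ W (y.1 0)}) 2 ((ST P).deviationExtend (Bh P) (ΨT P)) := by
    refine le_trans ?_ (enorm_iteratedFDeriv_le_supCkENorm (Nat.zero_le 2) hmem _)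
    rw [← ofReal_norm, norm_iteratedFDeriv_zero, (ST P).deviationExtend_coe (Bh P) (ΨT P) x]
    exact ENNReal.ofReal_le_ofReal hxdev
  have hlt : ENNReal.ofReal (cTw / 2) < ENNReal.ofReal cTw :=
    (ENNReal.ofReal_lt_ofReal_iff cTw_pos).mpr (half_lt_self cTw_pos)
  exact absurd (hge.trans hsmall) (not_le.mpr hlt)

/-! ## Packaged: honest inputs with a genuine gap exist -/

/-- **HONEST, NOT SELF-CERTIFIED INPUTS EXIST (Core shape).**  There are a spacetime, a region, a `C⁴`
final-state decomposition `d` with a hole and `R₀` such that the hypothesis bundles of the physics stub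
`OfCore.GapCoreHolds` — `HonestCore` (`Literature.Uncategorized.HonestCore`, the crux's `Hc`), `OfCore.HonestFar`
(the crux's `Hf`), `OfCore.DistinctVelocities` (DV) — hold, and for EVERY hole the input chart is NOT self-certified
below any normalised dominating wall (the negated clause of `OfCore.GapCoreHolds`, verbatim): the twisted exact
Schwarzschild exterior `decompT P 4`.  Hence the v5 self-certified split of the line `Sketch` does not make the
physics stub vacuous on honest inputs — a genuine, `C⁰`-visible gap between the fixed-radius-certified zone and the
wall is compatible with every typed honesty clause.  What it does not touch: maximal vacuum Cauchy developments of
admissible data with `O = exteriorOf …` (no model with a hole exists in the tree) and the physics. [folklore] -/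
theorem exists_honest_not_selfCertified : ∃ (𝓢 : Spacetime.{0} 4) (O : Set 𝓢.carrier) (d : FinalStateDecomposition 𝓢 O 4) (R₀ : ℝ), 0 < d.N ∧ Literature.Uncategorized.HonestCore 𝓢 O 4 d R₀ ∧ OfCore.HonestFar 𝓢 O 4 d R₀ ∧ OfCore.DistinctVelocities d ∧ ∀ i : Fin d.N, ¬ ∃ (T₀ : ℝ) (W : ℝ → ℝ), Continuous W ∧ Monotone W ∧ Tendsto (fun s ↦ W s / s) atTop (𝓝 0) ∧ (∀ s s', s ≤ s' → W s' ≤ W s + 1 / (10 * ‖(((d.motion i).1 : E4 ≃L[ℝ] E4) : E4 →L[ℝ] E4)‖ ^ 2) * (s' - s)) ∧ (∀ s, R₀ + 2 ≤ W s) ∧ (∀ s, T₀ ≤ s → 3 * d.excision i s + 2 ≤ W s) ∧ Tendsto (fun τ ↦ supCkENorm (Subtype.val '' {x : (d.background i).domain | (d.background i).time x.1 = τ ∧ (d.background i).radius x.1 ≤ W (x.1 0)}) 2 (𝓢.deviationExtend (d.background i) (d.chart i))) atTop (𝓝 0) := by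
  -- mass `1`, horizon-penetrating inner radius `1 < 2M`, anchoring radius `100 = 100M`
  let P : Params := ⟨1, 1, 100, one_pos, one_pos, by norm_num, by norm_num⟩
  exact ⟨ST P, O P, decompT P 4, P.R₀, Nat.one_pos, honestCore_decompT P 4, honestFar_decompT P 4,
    distinctVelocities_decompT P 4, not_selfCertified_decompT P 4⟩

end Summit.FinalStateConjecture.FinalStateConjecture.Theorems.NeckGapDecay.ConnectionLevelCones.Twist

end
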